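/-
Copyright (c) 2026 the pub-hodgecm-mathlib formalisation cell (harness21).  Prover seat hodgecm-mathlib-LH7-p09 (g2), CLOSE-OUT ROSTER strike line L3∕L5 (Track A
«(D-RAM) FOUR-FRAME» squad F0∕P3c∕LH4 ∕ F0∕P3c∕LH7); β₂-BOARD row (L-P) (lineage LH7-p09), the per-vertex → per-cell JUNCTION for the β₂ sub-dealer LH4-p04 (g9)'s
(L-Σ-3B) ED. 2 over the generic cone ledger `beta2ConesB.letter.v2`; helper lane on h413 = stmt-HodgeConjecture-24833 (count-neutral).  2026-09-04.
-/
import Summits.HodgeConjecture.HodgeConjecture.Theorems.F0P3cDyRamDeepConeCellOffShell     -- ★ p862651 (this seat): DEEP head; brings ★ p862572 TERMINAL head, ★ `…ShellLineModel`, ★ (E1) block-glue letters, ★ DEFS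
import Summits.HodgeConjecture.HodgeConjecture.Theorems.F0P3cDyRamConeGlueNormTransport    -- ★ (LH4-p12 lineage): `exists_coneData_of_gen` (the CANONICAL `w₀`, (G1), (gen), (norm) of a cone cell member)
import HarnessLib

/-!
# Crux `H413`, line LH4 «(D-RAM) FOUR-FRAME» — the (β₂) road (R-36) «PURE-CELL LEDGER», row (L-P) ∕ (L-Σ-3B) ED. 2: «EVERY GLUED VERTEX OVER A CONE-CELL MEMBER HAS A
# CANONICAL PRESENTATION» — the junction that turns a per-vertex head over ★ `…ShellLineModel`'s glued-vertex letters into a statement about the cell's labelled subsets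

Cell `hodgecm-mathlib` (D-0151), FLOOR 0, crux item H413 = `stmt-HodgeConjecture-24833`, route of record `HCCMUnconditional`; squads F0∕P3c∕LH4 ∕ LH7; lane
`--supports stmt-HodgeConjecture-24833 --as helper` (count-neutral; pays NO tier-0 row).  THEOREMS ONLY (no `def`, no instance, no notation, no `sorry`, default heartbeats);
★-only imports; states NO law; (β₂) stays a HYPOTHESIS.  DATUM-FREE: ★ p861044∕p861305's block frame (plane `(E², H₂)`, `σ` an isometric involution, `H₂` hermitian with unit
determinant, middle entry `h_W` a unit, `|ϖ| = exp(−1)`), the line model `(M, jE, ρ, Θ, α; φ, lam, h)` of ★ (C1), ★ DEFS `levelSetDep`.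

WHY.  In the generic cone ledger `beta2ConesB.letter.v2` (LH4-p04 (g9), 22:50Z) a cone cell `(j, b)` of a literal is the set
`levelSetDep ρ Θ α ϖE h j b μ ∩ {Λ | ∃ B, φ(B) = Λ ∧ ∃ L₃, SD L₃ ∧ L₃ ∩ W = ι_W B ∧ tube_b L₃ ∧ (LatticeNearTransvShell ϖ ℓ₀ m (Γ − 1) L₃ ∧ label)}` (★ p861305's canonical
labels), whereas the per-vertex heads of the board (★ p861810 clean, ★ p862037 boundary, ★ p862103 ∕ ★ p862572 terminal, ★ p862651 deep) speak about ONE glued vertex `L` through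
★ `…ShellLineModel`'s letters: a generator `g₀ ∈ L` with `|g₀,₁|·|ϖ|^b = 1` whose `W`-part is the CANONICAL dual generator `w₀`, `φ w₀ = Y⁻¹x₀`, of the presentation `Λ = x₀·𝒪_j`,
`Y = dualGen ρ Θ α (ϖE^j) h x₀`.  THIS FILE proves that every `L₃` in the cell's set admits such a presentation (§1), so that each head folds the cell (§2):
* §1 `exists_presentation_of_mem_levelSetDep` — from `Λ ∈ levelSetDep(j, b; μ)`, `φ(B) = Λ`, `L₃` self-dual with `W`-part `ι_W B` and tube `b ≥ 1`: `∃ x₀ w₀ g₀` carrying ALL the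
  glued-vertex letters (`hΛx hw₀Y hpr hg₀ hg₀1 hprg`) and the three `Y`-letters (`hYO hYp hYb`).  ROAD: ★ `exists_coneData_of_gen` gives the canonical `w₀` with (G1) `B = B^♯ ∩ {|⟨w₀, ·⟩| ≤ 1}`,
  (gen) `B^♯ = 𝒪·w₀ + B`, (norm) `|⟨w₀, w₀⟩| = |ϖ|^{−2b}` for a `B′` with `φ(B′) = Λ`, and `B′ = B` (★ `map_toAddSubgroup_injective`); ★ `exists_tubeCoordinate` gives a generator `x₁`
  of `L₃`; its `W`-part lies in `B^♯` (self-duality, ★ block pairing), so `pr_W x₁ = t·w₀ + a`; the glue module of `L₃` has length EXACTLY `2b` (★ `exists_smul_add_of_tubeCoordinate`),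
  which with (G1)+(norm) forces `|t| = 1`; `g₀ := t⁻¹·(x₁ − ι_W a)`.
* §2 THE FOLDS (ℓ₀ = 0): `levelSetDep_inter_shell_eq_empty_of_deep` (any `q`; ★ p862651) and `…_of_terminal` (`#𝓀[E] = 2`; ★ p862572) — the subset of the cell cut out by
  `∃ B … ∃ L₃ … (LatticeNearTransvShell ϖ 0 m (Γ − 1) L₃ ∧ P L₃)` is EMPTY for every square level `m` and every trailing predicate `P` (both labels at once), so both finsums of
  such a cell in `beta2ConesB` vanish by `finsum_mem_empty` after `Set.inter_empty`-style rewriting.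
HONEST LABEL.  Count-neutral lattice bookkeeping; nothing printed is asserted; no census law is stated; `HC_CM` is proved only modulo the 7 printed citations (2 remaining named inputs:
hLiu418 = `stmt-HodgeConjecture-24832`, h413 = `stmt-HodgeConjecture-24833`) until rung 0 closes.
## References
* [Jacobowitz1962] R. Jacobowitz, *Hermitian forms over local fields*, Amer. J. Math. 84 (1962): §4 (duals, modular components, gluing).
* [BruhatTits1972] F. Bruhat, J. Tits, *Groupes réductifs sur un corps local I*, Publ. Math. IHÉS 41 (1972): §10.
* [Kottwitz1986BaseChangeUnits] R. E. Kottwitz, *Base change for unit elements of Hecke algebras*, Compositio Math. 60 (1986): §1 pp. 240–241, §3.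
* [Rogawski1990] J. D. Rogawski, *Automorphic Representations of Unitary Groups in Three Variables*, Ann. of Math. Stud. 123 (1990): §4.9 Prop. 4.9.1 (b) p. 55.
-/

set_option autoImplicit false

noncomputable section

namespace Summit.HodgeConjecture.HodgeConjecture.Cruxes.H413.F0P3cDyRamConeCellPresentation

open scoped Valued WithZero Matrix MatrixGroups
open WithZero
open Literature.NumberTheory.Automorphic Literature.NumberTheory.Automorphic.HermitianLattice Literature.NumberTheory.Automorphic.UnitaryLatticeTree
open Literature.NumberTheory.Automorphic.EllipticPlaneAsFieldLine
open Literature.NumberTheory.Rogawski1990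
open Summit.HodgeConjecture.HodgeConjecture.Cruxes.H413.F0P3cDyRamToricCensusDefs
open Summit.HodgeConjecture.HodgeConjecture.Cruxes.H413.F0P3cDyRamFourFrameCensusDefs (LatticeInLevel LatticeNearTransvShell)
open Summit.HodgeConjecture.HodgeConjecture.Cruxes.H413.F0P3cDyRamConeLevelTransport (exists_coneData_of_gen)
open Summit.HodgeConjecture.HodgeConjecture.Cruxes.H413.F0P3cDyRamBlockGlueLabelFibreConstant (forall_v_apply_one_mul_le_of_tube)
open Summit.HodgeConjecture.HodgeConjecture.Cruxes.H413.F0P3cDyRamBoundaryCellLetterCardTwo (v_map_lt_one_iff_of_le_iff)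
open Summit.HodgeConjecture.HodgeConjecture.Cruxes.H413.F0P3cDyRamDeepConeCellOffShell (not_latticeNearTransvShell_zero_of_deep)
open Summit.HodgeConjecture.HodgeConjecture.Cruxes.H413.F0P3cDyRamTerminalCellOffShellCardTwo (not_latticeNearTransvShell_zero_of_terminal)

variable {E M : Type} [Field E] [Valued E ℤᵐ⁰] [Field M] [Valued M ℤᵐ⁰] {ρ Θ : M →+* M} {α : M}

/-! ## §1 The canonical presentation of a glued vertex over a cone-cell member -/

/-- **EVERY GLUED VERTEX OVER A CONE-CELL MEMBER HAS A CANONICAL PRESENTATION.**  Block frame (`σ` isometric involution, `|ϖ| = exp(−1)`, `H₂` hermitian with unit determinant,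
`|h_W| = 1`), line model `(M, jE, ρ, Θ, α; φ, lam, h)` (★ (C1) letters), `u` the literal's line value; `Λ ∈ levelSetDep(j, b; lam − jE u)` with `1 ≤ b`, `lam ∈ 𝒪_j`; `φ(B) = Λ`;
`L` self-dual for the block form with `L ∩ W = ι_W B` and tube coordinate `b`.  THEN there are `x₀`, `w₀`, `g₀` with: `Λ = x₀·𝒪_j`; `Y := dualGen ρ Θ α (ϖE^j) h x₀ ∈ 𝒪_j`,
Gram-primitive, `|Y| = |ϖE|^b`; `φ w₀ = Y⁻¹x₀`; `|x,₁|·|ϖ|^b ≤ 1` on `L`; `g₀ ∈ L`, `|g₀,₁|·|ϖ|^b = 1`, `pr_W g₀ = ι_W w₀` — the glued-vertex letters of ★ `…ShellLineModel` VERBATIM.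
[cite: Jacobowitz1962, §4] [cite: BruhatTits1972, §10] [cite: Kottwitz1986BaseChangeUnits, §1 pp. 240–241] -/
theorem exists_presentation_of_mem_levelSetDep
    (σ : E →+* E) (hσ : ∀ a, σ (σ a) = a) (hvσ : ∀ a, Valued.v (σ a) = Valued.v a) {ϖ : E} (hϖ : Valued.v ϖ = exp (-1 : ℤ))
    {H₂ : Matrix (Fin 2) (Fin 2) E} (hH₂ : IsUnit H₂.det) (hH₂σ : (H₂.map σ)ᵀ = H₂) {hW : E} (hhW : Valued.v hW = 1)
    (jE : E →+* M) (hρρ : ∀ x, ρ (ρ x) = x) (hvρ : ∀ x, Valued.v (ρ x) = Valued.v x) (hα : ρ α ≠ α) (hα1 : Valued.v α ≤ 1)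
    (hint : ∀ z : M, Valued.v z ≤ 1 → Valued.v ((z - ρ z) / (α - ρ α)) ≤ 1)
    (hΘΘ : ∀ x, Θ (Θ x) = x) (hΘρ : ∀ x, Θ (ρ x) = ρ (Θ x)) (hvΘ : ∀ x, Valued.v (Θ x) = Valued.v x)
    (hjv : ∀ c, Valued.v (jE c) ≤ 1 ↔ Valued.v c ≤ 1) (hjfix : ∀ z, ρ z = z ↔ ∃ c, jE c = z)
    (hjpow : ∀ (t : E) (n : ℤ), Valued.v (jE t) = Valued.v (jE ϖ) ^ n ↔ Valued.v t = Valued.v ϖ ^ n)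
    (hϖmax : ∀ t : M, ρ t = t → Valued.v t < 1 → Valued.v t ≤ Valued.v (jE ϖ))
    (φ : (Fin 2 → E) →+ M) (hφs : ∀ (c : E) (x : Fin 2 → E), φ (c • x) = jE c * φ x) (hφi : Function.Injective φ) (hφo : Function.Surjective φ)
    {γ₂ : GL (Fin 2) E} {lam h : M} (hφγ : ∀ x, φ ((γ₂ : Matrix (Fin 2) (Fin 2) E).mulVec x) = lam * φ x) (hlam : Valued.v lam = 1)
    (hΘh : Θ h = h) (hh : h ≠ 0) (hform : ∀ x y, jE (pairing σ H₂ x y) = h * Θ (φ x) * φ y + ρ (h * Θ (φ x) * φ y))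
    (u : E) {b : ℕ} (hb1 : 1 ≤ b) {j : ℕ} (hlamj : IsOrd ρ α (jE ϖ ^ j) lam)
    {Λ : AddSubgroup M} (hΛ : Λ ∈ levelSetDep ρ Θ α (jE ϖ) h j b (lam - jE u))
    {B : Submodule 𝒪[E] (Fin 2 → E)} (hBΛ : B.toAddSubgroup.map φ = Λ)
    {L : Submodule 𝒪[E] (Fin 3 → E)} (hL : IsSelfDualLattice σ ϖ (!![H₂ 0 0, 0, H₂ 0 1; 0, hW, 0; H₂ 1 0, 0, H₂ 1 1] : Matrix (Fin 3) (Fin 3) E) L)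
    (hLB : L ⊓ LinearMap.ker ((LinearMap.proj (1 : Fin 3) : (Fin 3 → E) →ₗ[E] E).restrictScalars 𝒪[E]) =
      B.map ((Matrix.toLin' (!![1, 0; 0, 0; 0, 1] : Matrix (Fin 3) (Fin 2) E)).restrictScalars 𝒪[E]))
    (htube : ∀ c : E, (Pi.single 1 c : Fin 3 → E) ∈ L ↔ Valued.v c ≤ Valued.v ϖ ^ b) :
    ∃ (x₀ : M) (w₀ : Fin 2 → E) (g₀ : Fin 3 → E), x₀ ≠ 0 ∧ (∀ x, x ∈ Λ ↔ ∃ z, IsOrd ρ α (jE ϖ ^ j) z ∧ x = x₀ * z) ∧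
      IsOrd ρ α (jE ϖ ^ j) (dualGen ρ Θ α (jE ϖ ^ j) h x₀) ∧ ¬ IsOrd ρ α (jE ϖ ^ j) (dualGen ρ Θ α (jE ϖ ^ j) h x₀ / jE ϖ) ∧
      Valued.v (dualGen ρ Θ α (jE ϖ ^ j) h x₀) = Valued.v (jE ϖ) ^ b ∧ φ w₀ = (dualGen ρ Θ α (jE ϖ ^ j) h x₀)⁻¹ * x₀ ∧
      (∀ x ∈ L, Valued.v (x 1) * Valued.v ϖ ^ b ≤ 1) ∧ g₀ ∈ L ∧ Valued.v (g₀ 1) * Valued.v ϖ ^ b = 1 ∧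
      g₀ - Pi.single 1 (g₀ 1) = ![w₀ 0, 0, w₀ 1] := by
  set H : Matrix (Fin 3) (Fin 3) E := !![H₂ 0 0, 0, H₂ 0 1; 0, hW, 0; H₂ 1 0, 0, H₂ 1 1] with hHdef
  set ι := ((Matrix.toLin' (!![1, 0; 0, 0; 0, 1] : Matrix (Fin 3) (Fin 2) E)).restrictScalars 𝒪[E]) with hιdef
  have hHcol : ∀ l : Fin 3, l ≠ 1 → H l 1 = 0 := fun l hl => endoShapeForm_col H₂ hW l hl
  have hH₂h : ∀ a c : Fin 2, σ (H₂ a c) = H₂ c a := fun a c => by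
    have e := congrFun (congrFun hH₂σ c) a
    rwa [Matrix.transpose_apply, Matrix.map_apply] at e
  have hsymm₂ : ∀ x y : Fin 2 → E, Valued.v (pairing σ H₂ y x) = Valued.v (pairing σ H₂ x y) := v_pairing_comm_of_hermitian hvσ hσ hH₂h
  have hvϖ0 : Valued.v ϖ ≠ 0 := by rw [hϖ]; exact exp_ne_zero
  have hϖ0 : ϖ ≠ 0 := fun h0 => hvϖ0 (by rw [h0, map_zero])
  have hϖlt : Valued.v ϖ < 1 := by rw [hϖ, ← exp_zero, exp_lt_exp]; norm_num
  have hϖbpos : 0 < Valued.v ϖ ^ b := pow_pos (zero_lt_iff.2 hvϖ0) _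
  have hιy : ∀ y : Fin 2 → E, ι y = ![y 0, 0, y 1] := fun y => by
    rw [hιdef, LinearMap.restrictScalars_apply, Matrix.toLin'_apply, planeMatrix_mulVec]
  -- `ι_W B ⊆ L`
  have hιmem : ∀ y ∈ B, (![y 0, 0, y 1] : Fin 3 → E) ∈ L := fun y hy => by
    have h1 : ι y ∈ B.map ι := ⟨y, hy, rfl⟩
    rw [← hLB] at h1
    rw [← hιy]; exact h1.1
  -- unpack the cell member
  rw [mem_levelSetDep_iff, mem_levelSet_iff] at hΛ
  obtain ⟨⟨x₀, hx₀, hΛx, hyO, hyp, hylev⟩, hdep⟩ := hΛ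
  -- the canonical cone data of `Λ`
  obtain ⟨B', hB'Λ, -, -, w₀, hw₀Y, hG1, hgen, hnorm, -⟩ :=
    exists_coneData_of_gen σ hϖ0 hϖlt H₂ jE hρρ hvρ hα hα1 hint hΘΘ hΘρ hvΘ hjv hjfix hjpow hϖmax φ hφs hφi hφo hφγ hlam hΘh hh hform u hb1 hx₀
      hΛx hyO hyp hylev hdep hlamj
  have hBB' : B' = B := map_toAddSubgroup_injective φ hφi (hB'Λ.trans hBΛ.symm)
  subst hBB'
  -- tube data of `L` and a generator `x₁`
  have hpr : ∀ x ∈ L, Valued.v (x 1) * Valued.v ϖ ^ b ≤ 1 := forall_v_apply_one_mul_le_of_tube σ hvσ hϖ hH₂ hhW hL htube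
  obtain ⟨b', hb', -, x₁, hx₁, hx₁1⟩ := exists_tubeCoordinate σ hvσ hϖ hH₂ hhW hL
  obtain ⟨hbb, -⟩ := tubeCoordinate_unique hϖ htube hb'
  subst hbb
  -- the `W`-part of the generator, read on the plane
  set w : Fin 3 → E := x₁ - Pi.single 1 (x₁ 1) with hw
  have hw1 : w 1 = 0 := by simp [hw]
  set w₂ : Fin 2 → E := ![w 0, w 2] with hw₂
  have hwpl : w = ![w₂ 0, 0, w₂ 1] := by
    rw [eq_plane_of_apply_one_eq_zero hw1, hw₂]
    simp
  -- `w₂ ∈ B^♯` (self-duality of `L`, block pairing)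
  have hLd : L ≤ dualLatt σ H L := le_dualLatt_of_isVertexLattice hvσ hL
  have hw₂d : w₂ ∈ dualLatt σ H₂ B' := by
    rw [mem_dualLatt]
    intro y hy
    have h1 := (mem_dualLatt σ H L x₁).1 (hLd hx₁) _ (hιmem y hy)
    have e : pairing σ H ![y 0, 0, y 1] x₁ = pairing σ H₂ y w₂ := by
      have h2 := pairing_sub_single_right_of_block σ H 1 hHcol ![y 0, 0, y 1] x₁
      rw [← hw, hwpl, pairing_endoShapeForm_plane σ H₂ hW y w₂] at h2
      rw [h2]
      simp
    rwa [e] at h1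
  -- `pr_W x₁ = t·w₀ + a`
  obtain ⟨t, a, ht, ha, hwta⟩ := hgen w₂ hw₂d
  -- the glue module of `L` has length exactly `2b`, so `t` is a unit
  obtain ⟨-, hglue⟩ := exists_smul_add_of_tubeCoordinate σ hvσ hϖ hhW hL hb1 htube hpr hx₁ hx₁1
  have hw₀B : ∀ s : E, Valued.v s ≤ Valued.v ϖ ^ (2 * b) → s • w₀ ∈ B' := fun s hs => by
    have hs1 : Valued.v s ≤ 1 := hs.trans (pow_le_one₀ zero_le hϖlt.le)
    refine (hG1 (s • w₀)).2 ⟨?_, ?_⟩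
    · rw [mem_dualLatt]
      intro y hy
      rw [map_smul, smul_eq_mul, Valuation.map_mul, hsymm₂]
      exact mul_le_one' hs1 ((hG1 y).1 hy).2
    · rw [map_smul, smul_eq_mul, Valuation.map_mul]
      calc Valued.v s * Valued.v (pairing σ H₂ w₀ w₀) ≤ Valued.v ϖ ^ (2 * b) * Valued.v (pairing σ H₂ w₀ w₀) := mul_le_mul_left hs _
        _ = 1 := by rw [mul_comm]; exact hnorm
  have ht1 : Valued.v t = 1 := by
    by_contra hne
    have htlt : Valued.v t < 1 := lt_of_le_of_ne ht hne
    have htϖ : Valued.v t ≤ Valued.v ϖ := by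
      have hx := WithZero.lt_mul_exp_iff_le (x := Valued.v t) (y := exp (-1 : ℤ)) exp_ne_zero
      rw [← exp_add, show (-1 : ℤ) + 1 = 0 by norm_num, exp_zero] at hx
      rw [hϖ]; exact hx.1 htlt
    -- `ϖ^{2b−1}·pr_W x₁ ∈ L`
    have hmem : ϖ ^ (2 * b - 1) • (x₁ - Pi.single 1 (x₁ 1)) ∈ L := by
      have e : ϖ ^ (2 * b - 1) • (x₁ - Pi.single 1 (x₁ 1)) =
          (![((ϖ ^ (2 * b - 1) * t) • w₀) 0, 0, ((ϖ ^ (2 * b - 1) * t) • w₀) 1] : Fin 3 → E) +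
            ![(ϖ ^ (2 * b - 1) • a) 0, 0, (ϖ ^ (2 * b - 1) • a) 1] := by
        rw [← hw, hwpl, hwta]
        ext i; fin_cases i <;> simp [mul_add, mul_assoc]
      rw [e]
      refine L.add_mem (hιmem _ (hw₀B _ ?_)) (hιmem _ (B'.smul_mem (⟨ϖ ^ (2 * b - 1), ?_⟩ : 𝒪[E]) ha))
      · rw [Valuation.map_mul, Valuation.map_pow]
        calc Valued.v ϖ ^ (2 * b - 1) * Valued.v t ≤ Valued.v ϖ ^ (2 * b - 1) * Valued.v ϖ := mul_le_mul_right htϖ _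
          _ = Valued.v ϖ ^ (2 * b) := by rw [← pow_succ]; congr 1; omega
      · rw [Valuation.mem_integer_iff, Valuation.map_pow]; exact pow_le_one₀ zero_le hϖlt.le
    have hle := (hglue (ϖ ^ (2 * b - 1))).1 hmem
    rw [Valuation.map_pow] at hle
    have hlt : Valued.v ϖ ^ (2 * b) < Valued.v ϖ ^ (2 * b - 1) := pow_lt_pow_right_of_lt_one₀ (zero_lt_iff.2 hvϖ0) hϖlt (by omega)
    exact absurd (lt_of_lt_of_le hlt hle) (lt_irrefl _)
  have ht0 : t ≠ 0 := fun h0 => by rw [h0, map_zero] at ht1; exact zero_ne_one ht1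
  -- concrete coordinates of the generator
  obtain ⟨p, q, r, hx₁v⟩ : ∃ p q r : E, x₁ = ![p, q, r] := ⟨x₁ 0, x₁ 1, x₁ 2, by ext i; fin_cases i <;> rfl⟩
  subst hx₁v
  have hp : p = t * w₀ 0 + a 0 := by
    have e := congrFun hwpl 0
    rw [hw, hwta] at e
    simpa using e
  have hr : r = t * w₀ 1 + a 1 := by
    have e := congrFun hwpl 2
    rw [hw, hwta] at e
    simpa using e
  have hq1 : Valued.v q * Valued.v ϖ ^ b = 1 := by simpa using hx₁1
  refine ⟨x₀, w₀, ![w₀ 0, t⁻¹ * q, w₀ 1], hx₀, hΛx, hyO, hyp, hylev, hw₀Y, hpr, ?_, ?_, ?_⟩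
  · have e : (![w₀ 0, t⁻¹ * q, w₀ 1] : Fin 3 → E) = t⁻¹ • ((![p, q, r] : Fin 3 → E) - ![a 0, 0, a 1]) := by
      ext i
      fin_cases i
      · simp [hp, ht0]
      · simp
      · simp [hr, ht0]
    rw [e]
    exact L.smul_mem (⟨t⁻¹, by rw [Valuation.mem_integer_iff, map_inv₀, ht1, inv_one]⟩ : 𝒪[E]) (L.sub_mem hx₁ (hιmem a ha))
  · have e : (![w₀ 0, t⁻¹ * q, w₀ 1] : Fin 3 → E) 1 = t⁻¹ * q := by simp
    rw [e, Valuation.map_mul, map_inv₀, ht1, inv_one, one_mul, hq1]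
  · ext i
    fin_cases i <;> simp

/-! ## §2 THE FOLDS at `ℓ₀ = 0`: the shell-cut subsets of a DEEP (any `q`) or TERMINAL (`q = 2`) cone cell are empty -/

/-- **FOLD — A DEEP CONE CELL HAS NO VERTEX ON ANY `ℓ₀ = 0` SHELL** (any `q`).  Block frame + line model (★ (C1) letters, `|jE c| ≤ 1 ↔ |c| ≤ 1`, `Fix ρ = jE(E)`), literal
`(γ₂, u)` with `|u₀₀ − 1| ≤ |ϖ^{m′}|`, `1 ≤ m′`; cone cell `(j, b)` with `1 ≤ b ≤ j` (`|ϖE^j| ≤ |ϖE|^b`), `lam ∈ 𝒪_j`; DEEP letters on `μ = lam − jE u₀₀`: `|μ| ≤ |ϖE|^{2b+1}`,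
`|μ − ρμ| ≤ |ϖE^j(α − ρα)|·|ϖE|^{b+1}`.  THEN for every square level `m` and every trailing predicate `P`, the subset of `levelSetDep(j, b; μ)` cut out by
`∃ B, φ(B) = Λ ∧ ∃ L₃, SD ∧ L₃ ∩ W = ι_W B ∧ tube_b ∧ (LatticeNearTransvShell ϖ 0 m (Γ − 1) L₃ ∧ P L₃)` is EMPTY (★ p862651 per vertex, §1 per cell).
[cite: Kottwitz1986BaseChangeUnits, §1 pp. 240–241; §3] [cite: Jacobowitz1962, §4] [cite: Rogawski1990, §4.9 Prop. 4.9.1 (b) p. 55] -/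
theorem levelSetDep_inter_shell_eq_empty_of_deep
    (σ : E →+* E) (hσ : ∀ a, σ (σ a) = a) (hvσ : ∀ a, Valued.v (σ a) = Valued.v a) {ϖ : E} (hϖ : Valued.v ϖ = exp (-1 : ℤ))
    {H₂ : Matrix (Fin 2) (Fin 2) E} (hH₂ : IsUnit H₂.det) (hH₂σ : (H₂.map σ)ᵀ = H₂) {hW : E} (hhW : Valued.v hW = 1)
    (jE : E →+* M) (hρρ : ∀ x, ρ (ρ x) = x) (hvρ : ∀ x, Valued.v (ρ x) = Valued.v x) (hα : ρ α ≠ α) (hα1 : Valued.v α ≤ 1)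
    (hint : ∀ z : M, Valued.v z ≤ 1 → Valued.v ((z - ρ z) / (α - ρ α)) ≤ 1)
    (hΘΘ : ∀ x, Θ (Θ x) = x) (hΘρ : ∀ x, Θ (ρ x) = ρ (Θ x)) (hvΘ : ∀ x, Valued.v (Θ x) = Valued.v x)
    (hjv : ∀ c, Valued.v (jE c) ≤ 1 ↔ Valued.v c ≤ 1) (hjfix : ∀ z, ρ z = z ↔ ∃ c, jE c = z)
    (hjpow : ∀ (t : E) (n : ℤ), Valued.v (jE t) = Valued.v (jE ϖ) ^ n ↔ Valued.v t = Valued.v ϖ ^ n)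
    (hϖmax : ∀ t : M, ρ t = t → Valued.v t < 1 → Valued.v t ≤ Valued.v (jE ϖ))
    (φ : (Fin 2 → E) →+ M) (hφs : ∀ (c : E) (x : Fin 2 → E), φ (c • x) = jE c * φ x) (hφi : Function.Injective φ) (hφo : Function.Surjective φ)
    {γ₂ : GL (Fin 2) E} {lam h : M} (hφγ : ∀ x, φ ((γ₂ : Matrix (Fin 2) (Fin 2) E).mulVec x) = lam * φ x) (hlam : Valued.v lam = 1)
    (hΘh : Θ h = h) (hh : h ≠ 0) (hform : ∀ x y, jE (pairing σ H₂ x y) = h * Θ (φ x) * φ y + ρ (h * Θ (φ x) * φ y))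
    (u : GL (Fin 1) E) {m' : ℕ} (hm1 : 1 ≤ m') (hum : Valued.v ((u : Matrix (Fin 1) (Fin 1) E) 0 0 - 1) ≤ Valued.v (ϖ ^ m'))
    {b j : ℕ} (hb1 : 1 ≤ b) (hbj : b ≤ j) (hlamj : IsOrd ρ α (jE ϖ ^ j) lam)
    (hμ : Valued.v (lam - jE ((u : Matrix (Fin 1) (Fin 1) E) 0 0)) ≤ Valued.v (jE ϖ) ^ (2 * b + 1))
    (hanti : Valued.v ((lam - jE ((u : Matrix (Fin 1) (Fin 1) E) 0 0)) - ρ (lam - jE ((u : Matrix (Fin 1) (Fin 1) E) 0 0))) ≤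
      Valued.v (jE ϖ ^ j * (α - ρ α)) * Valued.v (jE ϖ) ^ (b + 1))
    (m : ℕ) (P : Submodule 𝒪[E] (Fin 3 → E) → Prop) :
    levelSetDep ρ Θ α (jE ϖ) h j b (lam - jE ((u : Matrix (Fin 1) (Fin 1) E) 0 0)) ∩
        {Λ | ∃ B : Submodule 𝒪[E] (Fin 2 → E), B.toAddSubgroup.map φ = Λ ∧
          ∃ L₃ : Submodule 𝒪[E] (Fin 3 → E), IsSelfDualLattice σ ϖ (!![H₂ 0 0, 0, H₂ 0 1; 0, hW, 0; H₂ 1 0, 0, H₂ 1 1] : Matrix (Fin 3) (Fin 3) E) L₃ ∧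
            L₃ ⊓ LinearMap.ker ((LinearMap.proj (1 : Fin 3) : (Fin 3 → E) →ₗ[E] E).restrictScalars 𝒪[E]) =
              B.map ((Matrix.toLin' (!![1, 0; 0, 0; 0, 1] : Matrix (Fin 3) (Fin 2) E)).restrictScalars 𝒪[E]) ∧
            (∀ c : E, (Pi.single 1 c : Fin 3 → E) ∈ L₃ ↔ Valued.v c ≤ Valued.v ϖ ^ b) ∧
            (LatticeNearTransvShell ϖ 0 m ((((endoGL (γ₂, u) : GL (Fin 3) E) : Matrix (Fin 3) (Fin 3) E) - 1)) L₃ ∧ P L₃)} = ∅ := by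
  have hvϖ0 : Valued.v ϖ ≠ 0 := by rw [hϖ]; exact exp_ne_zero
  have hϖ0 : ϖ ≠ 0 := fun h0 => hvϖ0 (by rw [h0, map_zero])
  have hϖlt : Valued.v ϖ < 1 := by rw [hϖ, ← exp_zero, exp_lt_exp]; norm_num
  have hjϖ0 : jE ϖ ≠ 0 := (map_ne_zero jE).2 hϖ0
  have hjϖle : Valued.v (jE ϖ) ≤ 1 := ((v_map_lt_one_iff_of_le_iff jE hjv ϖ).2 hϖlt).le
  have hcb : Valued.v (jE ϖ ^ j) ≤ Valued.v (jE ϖ) ^ b := by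
    rw [Valuation.map_pow]; exact pow_le_pow_right_of_le_one' hjϖle hbj
  refine Set.subset_empty_iff.1 fun Λ hΛ => ?_
  obtain ⟨hΛ, B, hBΛ, L₃, hL, hLB, htube, hshell, -⟩ := hΛ
  obtain ⟨x₀, w₀, g₀, hx₀, hΛx, hyO, -, hylev, hw₀Y, hpr, hg₀, hg₀1, hprg⟩ :=
    exists_presentation_of_mem_levelSetDep σ hσ hvσ hϖ hH₂ hH₂σ hhW jE hρρ hvρ hα hα1 hint hΘΘ hΘρ hvΘ hjv hjfix hjpow hϖmax φ hφs hφi hφo hφγ hlam hΘh hh hform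
      ((u : Matrix (Fin 1) (Fin 1) E) 0 0) hb1 hlamj hΛ hBΛ hL hLB htube
  have hY0 : dualGen ρ Θ α (jE ϖ ^ j) h x₀ ≠ 0 := fun h0 => by
    rw [h0, Valuation.map_zero] at hylev
    exact pow_ne_zero b ((Valuation.ne_zero_iff _).2 hjϖ0) hylev.symm
  exact not_latticeNearTransvShell_zero_of_deep hvρ hα hα1 hϖ jE hjv hjfix φ hφs hφi hφγ htube hpr hLB.symm hg₀ hg₀1 hprg hBΛ hx₀ hΛx hw₀Y hyO hylev hcb
    u hm1 hum hμ hanti m hshell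

/-- **FOLD — THE TERMINAL CONE CELL HAS NO VERTEX ON ANY `ℓ₀ = 0` SHELL** (`#𝓀[E] = 2`).  Same frame + `hEval`; cone cell `(j, b)` with `1 ≤ b < j`; TERMINAL letters
`|μ| = |ϖE|^{2b}` (the row `2b = m₀`) and `|μ − ρμ| = |ϖE^j(α − ρα)·Y|`-shaped — stated through the CELL: `|μ − ρμ| = |ϖE^j(α − ρα)|·|ϖE|^b` (`j + b = jl′`; on the cell
`|Y| = |ϖE|^b`).  THEN the shell-cut subset of `levelSetDep(j, b; μ)` is EMPTY for every `m`, `P` (★ p862572 per vertex, §1 per cell).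
[cite: Kottwitz1986BaseChangeUnits, §1 pp. 240–241; §3] [cite: Serre1979, Ch. I §1] [cite: Rogawski1990, §4.9 Prop. 4.9.1 (b) p. 55] -/
theorem levelSetDep_inter_shell_eq_empty_of_terminal [Fintype 𝓀[E]] (hq : Fintype.card 𝓀[E] = 2)
    (σ : E →+* E) (hσ : ∀ a, σ (σ a) = a) (hvσ : ∀ a, Valued.v (σ a) = Valued.v a) {ϖ : E} (hϖ : Valued.v ϖ = exp (-1 : ℤ))
    {H₂ : Matrix (Fin 2) (Fin 2) E} (hH₂ : IsUnit H₂.det) (hH₂σ : (H₂.map σ)ᵀ = H₂) {hW : E} (hhW : Valued.v hW = 1)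
    (jE : E →+* M) (hρρ : ∀ x, ρ (ρ x) = x) (hvρ : ∀ x, Valued.v (ρ x) = Valued.v x) (hα : ρ α ≠ α) (hα1 : Valued.v α ≤ 1)
    (hint : ∀ z : M, Valued.v z ≤ 1 → Valued.v ((z - ρ z) / (α - ρ α)) ≤ 1)
    (hΘΘ : ∀ x, Θ (Θ x) = x) (hΘρ : ∀ x, Θ (ρ x) = ρ (Θ x)) (hvΘ : ∀ x, Valued.v (Θ x) = Valued.v x)
    (hjv : ∀ c, Valued.v (jE c) ≤ 1 ↔ Valued.v c ≤ 1) (hjfix : ∀ z, ρ z = z ↔ ∃ c, jE c = z)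
    (hjpow : ∀ (t : E) (n : ℤ), Valued.v (jE t) = Valued.v (jE ϖ) ^ n ↔ Valued.v t = Valued.v ϖ ^ n)
    (hEval : ∀ c : M, ρ c = c → c ≠ 0 → Valued.v c ≤ 1 → ∃ n : ℕ, Valued.v c = Valued.v (jE ϖ) ^ n)
    (hϖmax : ∀ t : M, ρ t = t → Valued.v t < 1 → Valued.v t ≤ Valued.v (jE ϖ))
    (φ : (Fin 2 → E) →+ M) (hφs : ∀ (c : E) (x : Fin 2 → E), φ (c • x) = jE c * φ x) (hφi : Function.Injective φ) (hφo : Function.Surjective φ)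
    {γ₂ : GL (Fin 2) E} {lam h : M} (hφγ : ∀ x, φ ((γ₂ : Matrix (Fin 2) (Fin 2) E).mulVec x) = lam * φ x) (hlam : Valued.v lam = 1)
    (hΘh : Θ h = h) (hh : h ≠ 0) (hform : ∀ x y, jE (pairing σ H₂ x y) = h * Θ (φ x) * φ y + ρ (h * Θ (φ x) * φ y))
    (u : GL (Fin 1) E) {m' : ℕ} (hm1 : 1 ≤ m') (hum : Valued.v ((u : Matrix (Fin 1) (Fin 1) E) 0 0 - 1) ≤ Valued.v (ϖ ^ m'))
    {b j : ℕ} (hb1 : 1 ≤ b) (hbj : b < j) (hlamj : IsOrd ρ α (jE ϖ ^ j) lam)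
    (hμ : Valued.v (lam - jE ((u : Matrix (Fin 1) (Fin 1) E) 0 0)) = Valued.v (jE ϖ) ^ (2 * b))
    (hanti : Valued.v ((lam - jE ((u : Matrix (Fin 1) (Fin 1) E) 0 0)) - ρ (lam - jE ((u : Matrix (Fin 1) (Fin 1) E) 0 0))) =
      Valued.v (jE ϖ ^ j * (α - ρ α)) * Valued.v (jE ϖ) ^ b)
    (m : ℕ) (P : Submodule 𝒪[E] (Fin 3 → E) → Prop) :
    levelSetDep ρ Θ α (jE ϖ) h j b (lam - jE ((u : Matrix (Fin 1) (Fin 1) E) 0 0)) ∩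
        {Λ | ∃ B : Submodule 𝒪[E] (Fin 2 → E), B.toAddSubgroup.map φ = Λ ∧
          ∃ L₃ : Submodule 𝒪[E] (Fin 3 → E), IsSelfDualLattice σ ϖ (!![H₂ 0 0, 0, H₂ 0 1; 0, hW, 0; H₂ 1 0, 0, H₂ 1 1] : Matrix (Fin 3) (Fin 3) E) L₃ ∧
            L₃ ⊓ LinearMap.ker ((LinearMap.proj (1 : Fin 3) : (Fin 3 → E) →ₗ[E] E).restrictScalars 𝒪[E]) =
              B.map ((Matrix.toLin' (!![1, 0; 0, 0; 0, 1] : Matrix (Fin 3) (Fin 2) E)).restrictScalars 𝒪[E]) ∧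
            (∀ c : E, (Pi.single 1 c : Fin 3 → E) ∈ L₃ ↔ Valued.v c ≤ Valued.v ϖ ^ b) ∧
            (LatticeNearTransvShell ϖ 0 m ((((endoGL (γ₂, u) : GL (Fin 3) E) : Matrix (Fin 3) (Fin 3) E) - 1)) L₃ ∧ P L₃)} = ∅ := by
  have hvϖ0 : Valued.v ϖ ≠ 0 := by rw [hϖ]; exact exp_ne_zero
  have hϖ0 : ϖ ≠ 0 := fun h0 => hvϖ0 (by rw [h0, map_zero])
  have hϖlt : Valued.v ϖ < 1 := by rw [hϖ, ← exp_zero, exp_lt_exp]; norm_num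
  have hjϖ0 : jE ϖ ≠ 0 := (map_ne_zero jE).2 hϖ0
  have hjϖlt : Valued.v (jE ϖ) < 1 := (v_map_lt_one_iff_of_le_iff jE hjv ϖ).2 hϖlt
  have hρϖ : ρ (jE ϖ) = jE ϖ := (hjfix _).2 ⟨ϖ, rfl⟩
  have hc : ρ (jE ϖ ^ j) = jE ϖ ^ j := by rw [map_pow, hρϖ]
  have hc0 : jE ϖ ^ j ≠ 0 := pow_ne_zero j hjϖ0
  have hcb : Valued.v (jE ϖ ^ j) < Valued.v (jE ϖ) ^ b := by
    rw [Valuation.map_pow]; exact pow_lt_pow_right_of_lt_one₀ (zero_lt_iff.2 ((Valuation.ne_zero_iff _).2 hjϖ0)) hjϖlt hbj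
  refine Set.subset_empty_iff.1 fun Λ hΛ => ?_
  obtain ⟨hΛ, B, hBΛ, L₃, hL, hLB, htube, hshell, -⟩ := hΛ
  obtain ⟨x₀, w₀, g₀, hx₀, hΛx, hyO, hyp, hylev, hw₀Y, hpr, hg₀, hg₀1, hprg⟩ :=
    exists_presentation_of_mem_levelSetDep σ hσ hvσ hϖ hH₂ hH₂σ hhW jE hρρ hvρ hα hα1 hint hΘΘ hΘρ hvΘ hjv hjfix hjpow hϖmax φ hφs hφi hφo hφγ hlam hΘh hh hform
      ((u : Matrix (Fin 1) (Fin 1) E) 0 0) hb1 hlamj hΛ hBΛ hL hLB htube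
  have hanti' : Valued.v ((lam - jE ((u : Matrix (Fin 1) (Fin 1) E) 0 0)) - ρ (lam - jE ((u : Matrix (Fin 1) (Fin 1) E) 0 0))) =
      Valued.v (jE ϖ ^ j * (α - ρ α) * dualGen ρ Θ α (jE ϖ ^ j) h x₀) := by
    rw [hanti, Valuation.map_mul _ (jE ϖ ^ j * (α - ρ α)), hylev]
  exact not_latticeNearTransvShell_zero_of_terminal hq hρρ hvρ hα hα1 hϖ jE hjv hjfix hEval φ hφs hφi hφγ htube hpr hLB.symm hg₀ hg₀1 hprg hBΛ hc hc0 hx₀ hΛx hw₀Y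
    hyO hyp hb1 hylev hcb u hm1 hum hμ hanti' m hshell

end Summit.HodgeConjecture.HodgeConjecture.Cruxes.H413.F0P3cDyRamConeCellPresentation

end
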